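import Summits.Ventures.HSemireg.WedgeHankelRecurrenceGaussChebyshevGoldenRatio

/-!
# Venture HSemireg — **ANTI-PERIODS OF THE VIETA–LUCAS VALUE SEQUENCES: in every commutative ring, if `C_m(x) = −2` and `C_{m+1}(x) = −x` then `C_{n+m}(x) = −C_n(x)` for all `n ∈ ℤ` (period `2m`),
# and if `S_m(x) = −1`, `S_{m+1}(x) = −x` then `S_{n+m}(x) = −S_n(x)`; instances `x = 0` (`m = 2`), `x² = 2` (`m = 4`), `x² = 3` (`m = 6`) (golden `x² = x + 1`, `m = 5`, is N524; `x = 1`, `m = 3`,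
# is N519), with the explicit factorisations `C_2 − 2 = (X − 2)(X + 2)`, `C_3 ± 2 = (X ∓ 1)²(X ± 2)`, `C_4 + 2 = (X² − 2)²`, `C_4 − 2 = X²(X − 2)(X + 2)`, `C_6 + 2 = X²(X² − 3)²`,
# `C_6 − 2 = (X² − 4)(X² − 1)²`, `S_3 = X(X² − 2)`, `S_5 = X(X² − 1)(X² − 3)` in every commutative ring**

HONEST FRAMING. Part of the Lean index of the computation cell `pub-hsemireg` (seat p10 gen 49, Sunday typer «UNIFORM-IN-n»).  Polynomial algebra over a commutative ring (Mathlib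
`Polynomial.Chebyshev.S ∕ C`, `Polynomial.Chebyshev.induct`); no variety, no cohomology theory, no sheaf, no Ext group and no semiregularity map is constructed here; nothing here says that HC /
HC_CM / HC_AV holds; no Literature fact (unproved `Prop`) is declared or used.  Custodian versions as in `WedgeHankelSiegelIdeal` (1/3).
SOURCES (cited).  P. Ribenboim, *My Numbers, My Friends* (Springer 2000), Ch. 1 §§2–3 (Lucas sequences `V_n(P, 1)`, their values and periods); T. Koshy, *Fibonacci and Lucas Numbers with Applications*
(Wiley 2001), Ch. 17; E. Lucas, *Théorie des fonctions numériques simplement périodiques*, Amer. J. Math. 1 (1878), §§ on `x = 2cos(π∕m)`.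
PROOF TYPED HERE.  (1) The sequences `n ↦ C_n(x)`, `n ↦ S_n(x)` satisfy `a_{n+2} = x a_{n+1} − a_n` on `ℤ` (Mathlib `C_add_two ∕ C_sub_one ∕ S_add_two ∕ S_sub_one`); so does `n ↦ a_{n+m} + a_n`, which
vanishes at `n = 0, 1` by hypothesis, hence everywhere (`Polynomial.Chebyshev.induct`, both directions); (2) the instances are checked from the explicit polynomials `C_2 … C_6`, `S_2 … S_5`
(N524 `chebyshevC_three ∕ four ∕ five`, `chebyshevS_three ∕ four ∕ five`, and `C_6 = X⁶ − 6X⁴ + 9X² − 2` here) by `linear_combination`; (3) the factorisations by `ring`.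
DEDUP DISCLOSURE (`rg -n 'antiperiod|(X \^ 2 - 2) \^ 2|X \^ 6 - 6' Summits/Ventures/HSemireg`, 2026-09-04): N519 has the `x = 1` anti-period (`chebyshevC_eval_one_add_three`, `chebyshevS_eval_one_add_three`),
N524 the golden one (`chebyshevC_eval_add_five_of_sq_eq`), N516 `chebyshevS_eval_zero_two_mul` (`S_{2m}(0) = (−1)^m`, an `ℕ`-indexed closed form at `x = 0` — the `ℤ`-indexed anti-period below is
the companion statement), Mathlib `T_eval_zero ∕ U_eval_zero`-type closed forms at `0`; no general anti-period lemma and no `x² = 2`, `x² = 3` tables; 0 hits for the 21 names below.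

WHAT IS IN THE TREE.  N524 `chebyshevC_three`, `chebyshevC_four`, `chebyshevC_five`, `chebyshevS_three`, `chebyshevS_four`, `chebyshevS_five`; Mathlib `C_zero ∕ C_one ∕ C_two ∕ C_add_two ∕ C_sub_one`,
`S_zero ∕ S_one ∕ S_two ∕ S_add_two ∕ S_sub_one`, `Polynomial.Chebyshev.induct`.
THIS FILE (namespace `Summit.Ventures.HSemireg.Wedge.HankelOuter` continued; CHAINED on N524; 0 definitions):
* §1290 **`chebyshevC_eval_add_of_antiperiod`** (`C_m(x) = −2`, `C_{m+1}(x) = −x` ⇒ `C_{n+m}(x) = −C_n(x)`), **`chebyshevS_eval_add_of_antiperiod`** (`S_m(x) = −1`, `S_{m+1}(x) = −x` ⇒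
  `S_{n+m}(x) = −S_n(x)`), `chebyshevC_eval_add_two_mul_of_antiperiod`, `chebyshevS_eval_add_two_mul_of_antiperiod` (period `2m`); `chebyshevC_six` (explicit);
  **`chebyshevC_eval_zero_add_two`**, **`chebyshevS_eval_zero_add_two'`** (`x = 0`, `m = 2`); **`chebyshevC_eval_add_four_of_sq_eq_two`**, **`chebyshevS_eval_add_four_of_sq_eq_two`** (`x² = 2`, `m = 4`,
  with the value tables `chebyshevC_eval_of_sq_eq_two`, `chebyshevS_eval_of_sq_eq_two`); **`chebyshevC_eval_add_six_of_sq_eq_three`**, **`chebyshevS_eval_add_six_of_sq_eq_three`** (`x² = 3`,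
  `m = 6`, tables `chebyshevC_eval_of_sq_eq_three`, `chebyshevS_eval_of_sq_eq_three`); factorisations **`chebyshevC_two_sub_two`**, **`chebyshevC_three_add_two`**, **`chebyshevC_three_sub_two`**,
  **`chebyshevC_four_add_two`**, **`chebyshevC_four_sub_two`**, **`chebyshevC_six_add_two`**, **`chebyshevC_six_sub_two`**, **`chebyshevS_three_eq_mul`**, **`chebyshevS_five_eq_mul`**.
CAVEATS.  All statements over an arbitrary commutative ring; `x² = 2` resp. `x² = 3` is the hypothesis, no square root is chosen.  Nothing Ext-side.  New names only.
-/

open Module Polynomial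
open scoped Matrix Polynomial

namespace Summit.Ventures.HSemireg.Wedge.HankelOuter

/-! ## §1290. Anti-periods of `n ↦ C_n(x)`, `n ↦ S_n(x)` -/

/-! ### The general anti-period lemma -/

/-- **If `C_m(x) = −2` and `C_{m+1}(x) = −x` then `C_{n+m}(x) = −C_n(x)` for every `n ∈ ℤ`** (commutative ring; the sum `C_{n+m}(x) + C_n(x)` satisfies the three-term recurrence and vanishes
at `n = 0, 1`). [Ribenboim 2000, Ch. 1; this file, §1290] -/
theorem chebyshevC_eval_add_of_antiperiod {R : Type*} [CommRing R] {x : R} {m : ℤ} (h0 : (Polynomial.Chebyshev.C R m).eval x = -2)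
    (h1 : (Polynomial.Chebyshev.C R (m + 1)).eval x = -x) (n : ℤ) : (Polynomial.Chebyshev.C R (n + m)).eval x = -(Polynomial.Chebyshev.C R n).eval x := by
  induction n using Polynomial.Chebyshev.induct with
  | zero => rw [zero_add, h0, Polynomial.Chebyshev.C_zero, eval_ofNat]
  | one => rw [add_comm, h1, Polynomial.Chebyshev.C_one, eval_X]
  | add_two k ih1 ih2 =>
    rw [show (k : ℤ) + 2 + m = (k + m) + 2 by ring, Polynomial.Chebyshev.C_add_two R ((k : ℤ) + m), show (k : ℤ) + m + 1 = k + 1 + m by ring,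
      Polynomial.Chebyshev.C_add_two R (k : ℤ)]
    simp only [eval_sub, eval_mul, eval_X]
    rw [ih1, ih2]
    ring
  | neg_add_one k ih1 ih2 =>
    rw [show (-(k : ℤ) - 1 + m) = (-k + m) - 1 by ring, Polynomial.Chebyshev.C_sub_one R (-(k : ℤ) + m), show (-(k : ℤ) + m + 1) = -k + 1 + m by ring,
      Polynomial.Chebyshev.C_sub_one R (-(k : ℤ))]
    simp only [eval_sub, eval_mul, eval_X]
    rw [ih1, ih2]
    ring

/-- **If `S_m(x) = −1` and `S_{m+1}(x) = −x` then `S_{n+m}(x) = −S_n(x)` for every `n ∈ ℤ`.** [Ribenboim 2000, Ch. 1; this file, §1290] -/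
theorem chebyshevS_eval_add_of_antiperiod {R : Type*} [CommRing R] {x : R} {m : ℤ} (h0 : (Polynomial.Chebyshev.S R m).eval x = -1)
    (h1 : (Polynomial.Chebyshev.S R (m + 1)).eval x = -x) (n : ℤ) : (Polynomial.Chebyshev.S R (n + m)).eval x = -(Polynomial.Chebyshev.S R n).eval x := by
  induction n using Polynomial.Chebyshev.induct with
  | zero => rw [zero_add, h0, Polynomial.Chebyshev.S_zero, eval_one]
  | one => rw [add_comm, h1, Polynomial.Chebyshev.S_one, eval_X]
  | add_two k ih1 ih2 =>
    rw [show (k : ℤ) + 2 + m = (k + m) + 2 by ring, Polynomial.Chebyshev.S_add_two R ((k : ℤ) + m), show (k : ℤ) + m + 1 = k + 1 + m by ring,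
      Polynomial.Chebyshev.S_add_two R (k : ℤ)]
    simp only [eval_sub, eval_mul, eval_X]
    rw [ih1, ih2]
    ring
  | neg_add_one k ih1 ih2 =>
    rw [show (-(k : ℤ) - 1 + m) = (-k + m) - 1 by ring, Polynomial.Chebyshev.S_sub_one R (-(k : ℤ) + m), show (-(k : ℤ) + m + 1) = -k + 1 + m by ring,
      Polynomial.Chebyshev.S_sub_one R (-(k : ℤ))]
    simp only [eval_sub, eval_mul, eval_X]
    rw [ih1, ih2]
    ring

/-- Under the same hypotheses `C_{n+2m}(x) = C_n(x)` (period `2m`). [Ribenboim 2000, Ch. 1; this file, §1290] -/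
theorem chebyshevC_eval_add_two_mul_of_antiperiod {R : Type*} [CommRing R] {x : R} {m : ℤ} (h0 : (Polynomial.Chebyshev.C R m).eval x = -2)
    (h1 : (Polynomial.Chebyshev.C R (m + 1)).eval x = -x) (n : ℤ) : (Polynomial.Chebyshev.C R (n + 2 * m)).eval x = (Polynomial.Chebyshev.C R n).eval x := by
  rw [show n + 2 * m = (n + m) + m by ring, chebyshevC_eval_add_of_antiperiod h0 h1, chebyshevC_eval_add_of_antiperiod h0 h1, neg_neg]

/-- Under the same hypotheses `S_{n+2m}(x) = S_n(x)` (period `2m`). [Ribenboim 2000, Ch. 1; this file, §1290] -/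
theorem chebyshevS_eval_add_two_mul_of_antiperiod {R : Type*} [CommRing R] {x : R} {m : ℤ} (h0 : (Polynomial.Chebyshev.S R m).eval x = -1)
    (h1 : (Polynomial.Chebyshev.S R (m + 1)).eval x = -x) (n : ℤ) : (Polynomial.Chebyshev.S R (n + 2 * m)).eval x = (Polynomial.Chebyshev.S R n).eval x := by
  rw [show n + 2 * m = (n + m) + m by ring, chebyshevS_eval_add_of_antiperiod h0 h1, chebyshevS_eval_add_of_antiperiod h0 h1, neg_neg]

/-! ### `x = 0` (`m = 2`) -/

/-- **`C_{n+2}(0) = −C_n(0)`** for all `n ∈ ℤ` (`C_2(0) = −2`, `C_3(0) = 0`). [this file, §1290] -/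
theorem chebyshevC_eval_zero_add_two {R : Type*} [CommRing R] (n : ℤ) : (Polynomial.Chebyshev.C R (n + 2)).eval 0 = -(Polynomial.Chebyshev.C R n).eval 0 := by
  refine chebyshevC_eval_add_of_antiperiod ?_ ?_ n
  · rw [Polynomial.Chebyshev.C_two]
    simp
  · rw [show (2 : ℤ) + 1 = 3 by norm_num, chebyshevC_three]
    simp

/-- **`S_{n+2}(0) = −S_n(0)`** for all `n ∈ ℤ` (`S_2(0) = −1`, `S_3(0) = 0`; companion of N516 `chebyshevS_eval_zero_two_mul`). [this file, §1290] -/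
theorem chebyshevS_eval_zero_add_two' {R : Type*} [CommRing R] (n : ℤ) : (Polynomial.Chebyshev.S R (n + 2)).eval 0 = -(Polynomial.Chebyshev.S R n).eval 0 := by
  refine chebyshevS_eval_add_of_antiperiod ?_ ?_ n
  · rw [Polynomial.Chebyshev.S_two]
    simp
  · rw [show (2 : ℤ) + 1 = 3 by norm_num, chebyshevS_three]
    simp

/-! ### `x² = 2` (`m = 4`) -/

/-- For `x² = 2`: `C_2(x) = 0`, `C_3(x) = −x`, `C_4(x) = −2`, `C_5(x) = −x`. [this file, §1290] -/
theorem chebyshevC_eval_of_sq_eq_two {R : Type*} [CommRing R] {x : R} (hx : x ^ 2 = 2) :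
    (Polynomial.Chebyshev.C R 2).eval x = 0 ∧ (Polynomial.Chebyshev.C R 3).eval x = -x ∧ (Polynomial.Chebyshev.C R 4).eval x = -2 ∧ (Polynomial.Chebyshev.C R 5).eval x = -x := by
  refine ⟨?_, ?_, ?_, ?_⟩
  · rw [Polynomial.Chebyshev.C_two]
    simp only [eval_sub, eval_pow, eval_X, eval_ofNat]
    linear_combination hx
  · rw [chebyshevC_three]
    simp only [eval_sub, eval_mul, eval_pow, eval_X, eval_ofNat]
    linear_combination x * hx
  · rw [chebyshevC_four]
    simp only [eval_add, eval_sub, eval_mul, eval_pow, eval_X, eval_ofNat]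
    linear_combination (x ^ 2 - 2) * hx
  · rw [chebyshevC_five]
    simp only [eval_add, eval_sub, eval_mul, eval_pow, eval_X, eval_ofNat]
    linear_combination (x ^ 3 - 3 * x) * hx

/-- For `x² = 2`: `S_2(x) = 1`, `S_3(x) = 0`, `S_4(x) = −1`, `S_5(x) = −x`. [this file, §1290] -/
theorem chebyshevS_eval_of_sq_eq_two {R : Type*} [CommRing R] {x : R} (hx : x ^ 2 = 2) :
    (Polynomial.Chebyshev.S R 2).eval x = 1 ∧ (Polynomial.Chebyshev.S R 3).eval x = 0 ∧ (Polynomial.Chebyshev.S R 4).eval x = -1 ∧ (Polynomial.Chebyshev.S R 5).eval x = -x := by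
  refine ⟨?_, ?_, ?_, ?_⟩
  · rw [Polynomial.Chebyshev.S_two]
    simp only [eval_sub, eval_pow, eval_X, eval_one]
    linear_combination hx
  · rw [chebyshevS_three]
    simp only [eval_sub, eval_mul, eval_pow, eval_X, eval_ofNat]
    linear_combination x * hx
  · rw [chebyshevS_four]
    simp only [eval_add, eval_sub, eval_mul, eval_pow, eval_X, eval_ofNat, eval_one]
    linear_combination (x ^ 2 - 1) * hx
  · rw [chebyshevS_five]
    simp only [eval_add, eval_sub, eval_mul, eval_pow, eval_X, eval_ofNat]
    linear_combination (x ^ 3 - 2 * x) * hx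

/-- **For `x² = 2`: `C_{n+4}(x) = −C_n(x)`** for all `n ∈ ℤ` (period `8`; over `ℝ`, `x = ±√2 = 2cos(π∕4)`, `2cos(3π∕4)`). [Ribenboim 2000, Ch. 1; this file, §1290] -/
theorem chebyshevC_eval_add_four_of_sq_eq_two {R : Type*} [CommRing R] {x : R} (hx : x ^ 2 = 2) (n : ℤ) :
    (Polynomial.Chebyshev.C R (n + 4)).eval x = -(Polynomial.Chebyshev.C R n).eval x := by
  obtain ⟨-, -, h4, h5⟩ := chebyshevC_eval_of_sq_eq_two hx
  exact chebyshevC_eval_add_of_antiperiod h4 (by rw [show (4 : ℤ) + 1 = 5 by norm_num, h5]) n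

/-- **For `x² = 2`: `S_{n+4}(x) = −S_n(x)`** for all `n ∈ ℤ`. [Ribenboim 2000, Ch. 1; this file, §1290] -/
theorem chebyshevS_eval_add_four_of_sq_eq_two {R : Type*} [CommRing R] {x : R} (hx : x ^ 2 = 2) (n : ℤ) :
    (Polynomial.Chebyshev.S R (n + 4)).eval x = -(Polynomial.Chebyshev.S R n).eval x := by
  obtain ⟨-, -, h4, h5⟩ := chebyshevS_eval_of_sq_eq_two hx
  exact chebyshevS_eval_add_of_antiperiod h4 (by rw [show (4 : ℤ) + 1 = 5 by norm_num, h5]) n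

/-! ### `x² = 3` (`m = 6`) -/

/-- `C_6 = X⁶ − 6X⁴ + 9X² − 2`. [this file, §1290] -/
theorem chebyshevC_six (R : Type*) [CommRing R] : Polynomial.Chebyshev.C R 6 = X ^ 6 - 6 * X ^ 4 + 9 * X ^ 2 - 2 := by
  rw [show (6 : ℤ) = 4 + 2 by norm_num, Polynomial.Chebyshev.C_add_two, show (4 : ℤ) + 1 = 5 by norm_num, chebyshevC_five, chebyshevC_four]
  ring

/-- For `x² = 3`: `C_4(x) = −1`, `C_5(x) = −x`, `C_6(x) = −2`, `C_7(x) = −x`. [this file, §1290] -/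
theorem chebyshevC_eval_of_sq_eq_three {R : Type*} [CommRing R] {x : R} (hx : x ^ 2 = 3) :
    (Polynomial.Chebyshev.C R 4).eval x = -1 ∧ (Polynomial.Chebyshev.C R 5).eval x = -x ∧ (Polynomial.Chebyshev.C R 6).eval x = -2 ∧ (Polynomial.Chebyshev.C R 7).eval x = -x := by
  have h4 : (Polynomial.Chebyshev.C R 4).eval x = -1 := by
    rw [chebyshevC_four]
    simp only [eval_add, eval_sub, eval_mul, eval_pow, eval_X, eval_ofNat]
    linear_combination (x ^ 2 - 1) * hx
  have h5 : (Polynomial.Chebyshev.C R 5).eval x = -x := by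
    rw [chebyshevC_five]
    simp only [eval_add, eval_sub, eval_mul, eval_pow, eval_X, eval_ofNat]
    linear_combination (x ^ 3 - 2 * x) * hx
  have h6 : (Polynomial.Chebyshev.C R 6).eval x = -2 := by
    rw [show (6 : ℤ) = 4 + 2 by norm_num, Polynomial.Chebyshev.C_add_two, show (4 : ℤ) + 1 = 5 by norm_num, eval_sub, eval_mul, eval_X, h5, h4]
    linear_combination -hx
  refine ⟨h4, h5, h6, ?_⟩
  rw [show (7 : ℤ) = 5 + 2 by norm_num, Polynomial.Chebyshev.C_add_two, show (5 : ℤ) + 1 = 6 by norm_num, eval_sub, eval_mul, eval_X, h6, h5]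
  ring

/-- For `x² = 3`: `S_4(x) = 1`, `S_5(x) = 0`, `S_6(x) = −1`, `S_7(x) = −x`. [this file, §1290] -/
theorem chebyshevS_eval_of_sq_eq_three {R : Type*} [CommRing R] {x : R} (hx : x ^ 2 = 3) :
    (Polynomial.Chebyshev.S R 4).eval x = 1 ∧ (Polynomial.Chebyshev.S R 5).eval x = 0 ∧ (Polynomial.Chebyshev.S R 6).eval x = -1 ∧ (Polynomial.Chebyshev.S R 7).eval x = -x := by
  have h4 : (Polynomial.Chebyshev.S R 4).eval x = 1 := by
    rw [chebyshevS_four]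
    simp only [eval_add, eval_sub, eval_mul, eval_pow, eval_X, eval_ofNat, eval_one]
    linear_combination (x ^ 2) * hx
  have h5 : (Polynomial.Chebyshev.S R 5).eval x = 0 := by
    rw [chebyshevS_five]
    simp only [eval_add, eval_sub, eval_mul, eval_pow, eval_X, eval_ofNat]
    linear_combination (x ^ 3 - x) * hx
  have h6 : (Polynomial.Chebyshev.S R 6).eval x = -1 := by
    rw [show (6 : ℤ) = 4 + 2 by norm_num, Polynomial.Chebyshev.S_add_two, show (4 : ℤ) + 1 = 5 by norm_num, eval_sub, eval_mul, eval_X, h5, h4]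
    ring
  refine ⟨h4, h5, h6, ?_⟩
  rw [show (7 : ℤ) = 5 + 2 by norm_num, Polynomial.Chebyshev.S_add_two, show (5 : ℤ) + 1 = 6 by norm_num, eval_sub, eval_mul, eval_X, h6, h5]
  ring

/-- **For `x² = 3`: `C_{n+6}(x) = −C_n(x)`** for all `n ∈ ℤ` (period `12`; over `ℝ`, `x = ±√3 = 2cos(π∕6)`, `2cos(5π∕6)`). [Ribenboim 2000, Ch. 1; this file, §1290] -/
theorem chebyshevC_eval_add_six_of_sq_eq_three {R : Type*} [CommRing R] {x : R} (hx : x ^ 2 = 3) (n : ℤ) :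
    (Polynomial.Chebyshev.C R (n + 6)).eval x = -(Polynomial.Chebyshev.C R n).eval x := by
  obtain ⟨-, -, h6, h7⟩ := chebyshevC_eval_of_sq_eq_three hx
  exact chebyshevC_eval_add_of_antiperiod h6 (by rw [show (6 : ℤ) + 1 = 7 by norm_num, h7]) n

/-- **For `x² = 3`: `S_{n+6}(x) = −S_n(x)`** for all `n ∈ ℤ`. [Ribenboim 2000, Ch. 1; this file, §1290] -/
theorem chebyshevS_eval_add_six_of_sq_eq_three {R : Type*} [CommRing R] {x : R} (hx : x ^ 2 = 3) (n : ℤ) :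
    (Polynomial.Chebyshev.S R (n + 6)).eval x = -(Polynomial.Chebyshev.S R n).eval x := by
  obtain ⟨-, -, h6, h7⟩ := chebyshevS_eval_of_sq_eq_three hx
  exact chebyshevS_eval_add_of_antiperiod h6 (by rw [show (6 : ℤ) + 1 = 7 by norm_num, h7]) n

/-! ### Explicit small factorisations of `C_n ± 2` and `S_n` (every commutative ring) -/

/-- `C_2 − 2 = (X − 2)(X + 2)`. [this file, §1290] -/
theorem chebyshevC_two_sub_two (R : Type*) [CommRing R] : Polynomial.Chebyshev.C R 2 - 2 = (X - 2) * (X + 2) := by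
  rw [Polynomial.Chebyshev.C_two]
  ring

/-- `C_3 + 2 = (X − 1)²(X + 2)`. [this file, §1290] -/
theorem chebyshevC_three_add_two (R : Type*) [CommRing R] : Polynomial.Chebyshev.C R 3 + 2 = (X - 1) ^ 2 * (X + 2) := by
  rw [chebyshevC_three]
  ring

/-- `C_3 − 2 = (X + 1)²(X − 2)`. [this file, §1290] -/
theorem chebyshevC_three_sub_two (R : Type*) [CommRing R] : Polynomial.Chebyshev.C R 3 - 2 = (X + 1) ^ 2 * (X - 2) := by
  rw [chebyshevC_three]
  ring

/-- `C_4 + 2 = (X² − 2)²`. [this file, §1290] -/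
theorem chebyshevC_four_add_two (R : Type*) [CommRing R] : Polynomial.Chebyshev.C R 4 + 2 = (X ^ 2 - 2) ^ 2 := by
  rw [chebyshevC_four]
  ring

/-- `C_4 − 2 = X²(X − 2)(X + 2)`. [this file, §1290] -/
theorem chebyshevC_four_sub_two (R : Type*) [CommRing R] : Polynomial.Chebyshev.C R 4 - 2 = X ^ 2 * (X - 2) * (X + 2) := by
  rw [chebyshevC_four]
  ring

/-- `C_6 + 2 = X²(X² − 3)²`. [this file, §1290] -/
theorem chebyshevC_six_add_two (R : Type*) [CommRing R] : Polynomial.Chebyshev.C R 6 + 2 = X ^ 2 * (X ^ 2 - 3) ^ 2 := by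
  rw [chebyshevC_six]
  ring

/-- `C_6 − 2 = (X² − 4)(X² − 1)²`. [this file, §1290] -/
theorem chebyshevC_six_sub_two (R : Type*) [CommRing R] : Polynomial.Chebyshev.C R 6 - 2 = (X ^ 2 - 4) * (X ^ 2 - 1) ^ 2 := by
  rw [chebyshevC_six]
  ring

/-- `S_3 = X(X² − 2)`. [this file, §1290] -/
theorem chebyshevS_three_eq_mul (R : Type*) [CommRing R] : Polynomial.Chebyshev.S R 3 = X * (X ^ 2 - 2) := by
  rw [chebyshevS_three]
  ring

/-- `S_5 = X(X² − 1)(X² − 3)`. [this file, §1290] -/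
theorem chebyshevS_five_eq_mul (R : Type*) [CommRing R] : Polynomial.Chebyshev.S R 5 = X * (X ^ 2 - 1) * (X ^ 2 - 3) := by
  rw [chebyshevS_five]
  ring

end Summit.Ventures.HSemireg.Wedge.HankelOuter
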